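import Mathlib

/-!
# `ConeLocalisation` (stmt-AtomisticToContinuum-12504): the density-floor gap — uniform `C³` guards do
# not bound relative density oscillation (the trough family)

Negative helper file of the standing crux disprover (`Cruxes/ConeLocalisation/Disproof.lean` §3;
refuter-cdisprove-stmt-AtomisticToContinuum-12504-0, 2026-08-17). Pure real analysis; no Theses
declaration is mentioned.

Context. The consequent `S` of `ConeLocalisation` guards the classical Euler solution on `[0, t]` at a
level `M` by `ρ ≤ M`, `θ ∈ [M⁻¹, M]`, `‖u‖ ≤ M` and all derivatives of order `≤ 3` bounded by `M` — with NO
lower bound on `ρ`. Every use of the hypothesis `NearConstantShortTimeHL` is on a comparison gas whose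
unit-mass density is `δ₀(M′)`-close to `1`, and the agreement clause of `LightConeInLaw` then forces the
RELATIVE oscillation of the given density over a cone base `B(x, 2ct)` to be `≤ 3δ₀` (crux ideators,
`Cruxes/ConeLocalisation/IdeatorTwoNotes.md` §1, `IdeatorOneNotes.md` §2). The one-parameter family
`f_κ(y) = 1 - (1 - κ) cos (2π y)` (lifted to `𝕋³` along one coordinate: unit mass, `u ≡ 0`, `θ ≡ 1`) shows
that a fixed guard level cannot deliver such a bound:

* `abs_deriv_trough_le`, `abs_deriv2_trough_le`, `abs_deriv3_trough_le` — `|f_κ′| ≤ 2π`,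
  `|f_κ″| ≤ (2π)²`, `|f_κ‴| ≤ (2π)³` for EVERY `κ ∈ [0, 1]`, and `κ ≤ f_κ ≤ 2 - κ` (`le_trough`, `trough_le`):
  the whole family sits in one guard class (`M = (2π)³ + 2`);
* `trough_relOsc_unbounded` — for every window `h ∈ (0, 1)` and every `K` some member has
  `f_κ(h) - f_κ(0) > K · f_κ(0)`: relative oscillation over `[0, h]` is unbounded in the class;
* `relOsc_le_of_floor` — the positive counterpart under a floor: `m ≤ f`, `|f′| ≤ L` give relative
  oscillation `≤ L h / m` over `[y, y + h]` (with `S♭`'s floor `M⁻¹ ≤ ρ` and `|∂ρ| ≤ M`: `≤ M² h`);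
* `localisation_schema_false` — the schema: conclusions licensed only under an oscillation bound `≤ δ`
  do not entail conclusions for a guard class containing a datum of oscillation `> δ` (explicit witness).

This is a PROVABILITY gap of the implication `LightConeInLaw → NearConstantShortTimeHL → S` through its
hypotheses, not a counterexample (`S` is implied by the summit conjunct). Repair endorsed: add the floor
`M⁻¹ ≤ ρ s x` to `S` in stmt-12504 and stmt-12503 (Disproof file §3).
-/

namespace Summit.AtomisticToContinuum.HydrodynamicLimit.Theorems.ConeLocalisationNegative

open Real Set

/-- Floor of the trough family: `κ ≤ f_κ(y)` for `κ ≤ 1`. [folklore] -/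
theorem le_trough {κ : ℝ} (hκ1 : κ ≤ 1) (y : ℝ) : κ ≤ 1 - (1 - κ) * Real.cos (2 * π * y) := by
  have hc := Real.cos_le_one (2 * π * y)
  nlinarith

/-- Ceiling of the trough family: `f_κ(y) ≤ 2 - κ` for `κ ≤ 1`. [folklore] -/
theorem trough_le {κ : ℝ} (hκ1 : κ ≤ 1) (y : ℝ) : 1 - (1 - κ) * Real.cos (2 * π * y) ≤ 2 - κ := by
  have hc := Real.neg_one_le_cos (2 * π * y)
  nlinarith

/-- `f_κ′(y) = (1 - κ)(2π) sin (2π y)`. [folklore] -/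
theorem hasDerivAt_trough (κ y : ℝ) :
    HasDerivAt (fun y => 1 - (1 - κ) * Real.cos (2 * π * y))
      ((1 - κ) * (2 * π) * Real.sin (2 * π * y)) y := by
  have h1 : HasDerivAt (fun y : ℝ => 2 * π * y) (2 * π) y := by
    simpa using (hasDerivAt_id y).const_mul (2 * π)
  exact (((h1.cos).const_mul (1 - κ)).const_sub 1).congr_deriv (by ring)

/-- `f_κ′ = (1 - κ)(2π) sin (2π ·)`. [folklore] -/
theorem deriv_trough (κ : ℝ) :
    deriv (fun y => 1 - (1 - κ) * Real.cos (2 * π * y)) =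
      fun y => (1 - κ) * (2 * π) * Real.sin (2 * π * y) :=
  funext fun y => (hasDerivAt_trough κ y).deriv

/-- `f_κ″(y) = (1 - κ)(2π)² cos (2π y)`. [folklore] -/
theorem hasDerivAt_deriv_trough (κ y : ℝ) :
    HasDerivAt (deriv fun y => 1 - (1 - κ) * Real.cos (2 * π * y))
      ((1 - κ) * (2 * π) ^ 2 * Real.cos (2 * π * y)) y := by
  rw [deriv_trough]
  have h1 : HasDerivAt (fun y : ℝ => 2 * π * y) (2 * π) y := by
    simpa using (hasDerivAt_id y).const_mul (2 * π)
  exact ((h1.sin).const_mul ((1 - κ) * (2 * π))).congr_deriv (by ring)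

/-- `f_κ″ = (1 - κ)(2π)² cos (2π ·)`. [folklore] -/
theorem deriv2_trough (κ : ℝ) :
    deriv^[2] (fun y => 1 - (1 - κ) * Real.cos (2 * π * y)) =
      fun y => (1 - κ) * (2 * π) ^ 2 * Real.cos (2 * π * y) :=
  funext fun y => (hasDerivAt_deriv_trough κ y).deriv

/-- `f_κ‴(y) = -(1 - κ)(2π)³ sin (2π y)`. [folklore] -/
theorem hasDerivAt_deriv2_trough (κ y : ℝ) :
    HasDerivAt (deriv^[2] fun y => 1 - (1 - κ) * Real.cos (2 * π * y))
      (-((1 - κ) * (2 * π) ^ 3 * Real.sin (2 * π * y))) y := by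
  rw [deriv2_trough]
  have h1 : HasDerivAt (fun y : ℝ => 2 * π * y) (2 * π) y := by
    simpa using (hasDerivAt_id y).const_mul (2 * π)
  exact ((h1.cos).const_mul ((1 - κ) * (2 * π) ^ 2)).congr_deriv (by ring)

/-- `f_κ‴ = -(1 - κ)(2π)³ sin (2π ·)`. [folklore] -/
theorem deriv3_trough (κ : ℝ) :
    deriv^[3] (fun y => 1 - (1 - κ) * Real.cos (2 * π * y)) =
      fun y => -((1 - κ) * (2 * π) ^ 3 * Real.sin (2 * π * y)) :=
  funext fun y => (hasDerivAt_deriv2_trough κ y).deriv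

/-- Arithmetic of the bounds: `|(1 - κ) c s| ≤ c` for `κ ∈ [0, 1]`, `c ≥ 0`, `|s| ≤ 1`. [folklore] -/
theorem abs_amp_mul_le {κ c s : ℝ} (hκ0 : 0 ≤ κ) (hκ1 : κ ≤ 1) (hc : 0 ≤ c) (hs : |s| ≤ 1) :
    |(1 - κ) * c * s| ≤ c := by
  have h1 : (1 - κ) * |s| ≤ 1 := by nlinarith [abs_nonneg s]
  calc |(1 - κ) * c * s| = c * ((1 - κ) * |s|) := by
        rw [abs_mul, abs_mul, abs_of_nonneg (by linarith : (0:ℝ) ≤ 1 - κ), abs_of_nonneg hc]; ring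
    _ ≤ c * 1 := mul_le_mul_of_nonneg_left h1 hc
    _ = c := mul_one _

/-- **Uniform `C¹` bound** of the trough family: `|f_κ′| ≤ 2π` for all `κ ∈ [0, 1]`. [folklore] -/
theorem abs_deriv_trough_le {κ : ℝ} (hκ0 : 0 ≤ κ) (hκ1 : κ ≤ 1) (y : ℝ) :
    |deriv (fun y => 1 - (1 - κ) * Real.cos (2 * π * y)) y| ≤ 2 * π := by
  simp only [deriv_trough]
  exact abs_amp_mul_le hκ0 hκ1 (by positivity) (Real.abs_sin_le_one _)

/-- **Uniform `C²` bound**: `|f_κ″| ≤ (2π)²` for all `κ ∈ [0, 1]`. [folklore] -/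
theorem abs_deriv2_trough_le {κ : ℝ} (hκ0 : 0 ≤ κ) (hκ1 : κ ≤ 1) (y : ℝ) :
    |deriv^[2] (fun y => 1 - (1 - κ) * Real.cos (2 * π * y)) y| ≤ (2 * π) ^ 2 := by
  simp only [deriv2_trough]
  exact abs_amp_mul_le hκ0 hκ1 (by positivity) (Real.abs_cos_le_one _)

/-- **Uniform `C³` bound**: `|f_κ‴| ≤ (2π)³` for all `κ ∈ [0, 1]`. [folklore] -/
theorem abs_deriv3_trough_le {κ : ℝ} (hκ0 : 0 ≤ κ) (hκ1 : κ ≤ 1) (y : ℝ) :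
    |deriv^[3] (fun y => 1 - (1 - κ) * Real.cos (2 * π * y)) y| ≤ (2 * π) ^ 3 := by
  simp only [deriv3_trough, abs_neg]
  exact abs_amp_mul_le hκ0 hκ1 (by positivity) (Real.abs_sin_le_one _)

/-- **Unbounded relative oscillation inside one guard class**: for every window `h ∈ (0, 1)` and every
`K` there is `κ ∈ (0, 1)` with `K · f_κ(0) < f_κ(h) - f_κ(0)`, i.e. `K κ < (1 - (1 - κ) cos (2πh)) - κ`
(`f_κ(0) = κ`). With `h = 2ct` this defeats, at every `t > 0`, any relative-oscillation requirement
`≤ 3δ₀(M′)` on cone bases. [folklore] -/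
theorem trough_relOsc_unbounded {h : ℝ} (hh0 : 0 < h) (hh1 : h < 1) (K : ℝ) :
    ∃ κ : ℝ, 0 < κ ∧ κ < 1 ∧ K * κ < (1 - (1 - κ) * Real.cos (2 * π * h)) - κ := by
  set g : ℝ := 1 - Real.cos (2 * π * h) with hg
  have hgpos : 0 < g := by
    have hne : Real.cos (2 * π * h) ≠ 1 := by
      intro hc
      have hlt1 : -(2 * π) < 2 * π * h := by nlinarith [Real.pi_pos]
      have hlt2 : 2 * π * h < 2 * π := by nlinarith [Real.pi_pos]
      have := (Real.cos_eq_one_iff_of_lt_of_lt hlt1 hlt2).1 hc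
      nlinarith [Real.pi_pos]
    have hle := Real.cos_le_one (2 * π * h)
    rw [hg]
    exact sub_pos.2 (lt_of_le_of_ne hle hne)
  refine ⟨min (1 / 2) (g / (2 * (|K| + 1))), lt_min (by norm_num) (by positivity),
    lt_of_le_of_lt (min_le_left _ _) (by norm_num), ?_⟩
  set κ : ℝ := min (1 / 2) (g / (2 * (|K| + 1))) with hκ
  have hκpos : 0 < κ := lt_min (by norm_num) (by positivity)
  have hκhalf : κ ≤ 1 / 2 := min_le_left _ _
  have hκg : κ ≤ g / (2 * (|K| + 1)) := min_le_right _ _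
  have hrw : (1 - (1 - κ) * Real.cos (2 * π * h)) - κ = (1 - κ) * g := by rw [hg]; ring
  rw [hrw]
  have hK : K * κ ≤ |K| * κ := mul_le_mul_of_nonneg_right (le_abs_self K) hκpos.le
  have h1 : |K| * κ ≤ |K| * (g / (2 * (|K| + 1))) := mul_le_mul_of_nonneg_left hκg (abs_nonneg K)
  have h2 : |K| * (g / (2 * (|K| + 1))) < g / 2 := by
    rw [mul_div_assoc', div_lt_div_iff₀ (by positivity) (by positivity)]
    nlinarith [abs_nonneg K]
  have h3 : g / 2 ≤ (1 - κ) * g := by nlinarith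
  linarith

/-- **The positive counterpart under a floor**: `0 < m ≤ f`, `|f′| ≤ L`, `0 ≤ h` give
`f(y + h) - f(y) ≤ (L h / m) · f(y)` (mean value inequality). [folklore] -/
theorem relOsc_le_of_floor {f : ℝ → ℝ} {m L y h : ℝ} (hm : 0 < m) (hh : 0 ≤ h)
    (hf : Differentiable ℝ f) (hfloor : ∀ z, m ≤ f z) (hderiv : ∀ z, |deriv f z| ≤ L) :
    f (y + h) - f y ≤ L * h / m * f y := by
  have hmv : ‖f (y + h) - f y‖ ≤ L * ‖y + h - y‖ :=
    Convex.norm_image_sub_le_of_norm_deriv_le (fun z _ => hf.differentiableAt)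
      (fun z _ => by simpa [Real.norm_eq_abs] using hderiv z) convex_univ (mem_univ y) (mem_univ (y + h))
  simp only [add_sub_cancel_left, Real.norm_eq_abs, abs_of_nonneg hh] at hmv
  have h1 : f (y + h) - f y ≤ L * h := le_trans (le_abs_self _) hmv
  have hL : 0 ≤ L * h := le_trans (abs_nonneg _) hmv
  have h2 : L * h ≤ L * h / m * f y := by
    rw [div_mul_eq_mul_div, le_div_iff₀ hm]
    exact mul_le_mul_of_nonneg_left (hfloor y) hL
  linarith

/-- **Schema of the gap** (explicit witness): if the guard class contains a datum of oscillation `> δ`,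
then "`L d` for every datum of oscillation `≤ δ`" does not entail "`L d` for every guarded datum" —
take `L d := (osc d ≤ δ)`. [folklore] -/
theorem localisation_schema_false {D : Type*} (osc : D → ℝ) (guard : D → Prop) (δ : ℝ)
    (hgap : ∃ d, guard d ∧ δ < osc d) :
    ¬ ∀ L : D → Prop, (∀ d, osc d ≤ δ → L d) → ∀ d, guard d → L d := by
  intro hyp
  obtain ⟨d, hd, hδ⟩ := hgap
  exact not_le.2 hδ (hyp (fun d => osc d ≤ δ) (fun d hd' => hd') d hd)

/-- The schema instantiated on the trough family: data = parameters `κ ∈ (0, 1)` (one guard class),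
oscillation = relative oscillation of `f_κ` over `[0, h]`; for every threshold `δ` the licensed conclusions
fail to entail the guarded ones. [folklore] -/
theorem trough_schema_false {h : ℝ} (hh0 : 0 < h) (hh1 : h < 1) (δ : ℝ) :
    ¬ ∀ L : ℝ → Prop,
      (∀ κ : ℝ, ((1 - (1 - κ) * Real.cos (2 * π * h)) - κ) / κ ≤ δ → L κ) →
      ∀ κ : ℝ, (0 < κ ∧ κ < 1) → L κ := by
  refine localisation_schema_false (fun κ => ((1 - (1 - κ) * Real.cos (2 * π * h)) - κ) / κ)
    (fun κ => 0 < κ ∧ κ < 1) δ ?_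
  obtain ⟨κ, hκ0, hκ1, hK⟩ := trough_relOsc_unbounded hh0 hh1 δ
  exact ⟨κ, ⟨hκ0, hκ1⟩, by rw [lt_div_iff₀ hκ0]; linarith⟩

end Summit.AtomisticToContinuum.HydrodynamicLimit.Theorems.ConeLocalisationNegative
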